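import Literature.NumberTheory.LFunctions.WeilExplicit
import Mathlib.MeasureTheory.Integral.IntegralEqImproper
import HarnessLib

/-!
# `WeilGroundState.GroundStatesConvergeToXi` — integration by parts for `weilMellin` without compact support
(crux item stmt-RiemannHypothesis-1527, route route-RiemannHypothesis-WeilGroundState; `--supports`)

`weilMellin h s = ∫ h(t) e^{(s−1/2)t} dt`. For differentiable `h` with `h e^{(s-1/2)t}`,
`h' e^{(s-1/2)t}` integrable on `ℝ` (NO compact support): `(h')^(s) = −(s−1/2) ĥ(s)`; twice:
`(h'')^(s) = (s−1/2)² ĥ(s)`; hence the decay `‖ĥ(s)‖ ≤ 2(τ₀ + τ₂)/(1 + (Im s)²)` in the closed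
strip `0 ≤ Re s ≤ 1` from the weighted norms `τ₀ ≥ ∫‖h‖e^{|t|/2}`, `τ₂ ≥ ∫‖h''‖e^{|t|/2}`.
(The tree's `weilMellin_deriv` / `norm_weilMellin_le` assume `IsWeilTest`, i.e. compact support;
here they are redone for tails of Riemann's kernel.)
-/

noncomputable section

set_option linter.dupNamespace false

open scoped Topology Real
open Filter Set MeasureTheory Complex

namespace Summit.RiemannHypothesis.RiemannHypothesis.Theorems.GroundStatesConvergeToXi

open Literature.NumberTheory.LFunctions

/-- **Integration by parts for `weilMellin` on `ℝ`**: if `h` has derivative `h'` everywhere and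
`h e^{(s-1/2)t}`, `h' e^{(s-1/2)t}` are integrable, then `(h')^(s) = −(s − 1/2) ĥ(s)`
(`MeasureTheory.integral_mul_deriv_eq_deriv_mul_of_integrable`). [folklore] -/
theorem weilMellin_of_hasDerivAt {h h' : ℝ → ℂ} {s : ℂ} (hd : ∀ t : ℝ, HasDerivAt h (h' t) t)
    (hi : Integrable fun t : ℝ => h t * cexp ((s - 1 / 2) * t))
    (hi' : Integrable fun t : ℝ => h' t * cexp ((s - 1 / 2) * t)) :
    weilMellin h' s = -(s - 1 / 2) * weilMellin h s := by
  unfold weilMellin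
  set w : ℂ := s - 1 / 2
  -- `u = e^{wt}`, `v = h`
  have hu : ∀ t : ℝ, HasDerivAt (fun t : ℝ ↦ cexp (w * t)) (w * cexp (w * t)) t := by
    intro t
    have h1 : HasDerivAt (fun t : ℝ ↦ w * (t : ℂ)) (w * 1) t :=
      (Complex.ofRealCLM.hasDerivAt.const_mul w).congr_deriv (by simp)
    have h2 := (Complex.hasDerivAt_exp (w * t)).comp t h1
    simpa [mul_comm, Function.comp_def] using h2
  have key := integral_mul_deriv_eq_deriv_mul_of_integrable (u := fun t : ℝ ↦ cexp (w * t))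
    (u' := fun t : ℝ ↦ w * cexp (w * t)) (v := h) (v' := h')
    (fun t _ ↦ hu t) (fun t _ ↦ hd t) ?_ ?_ ?_
  · calc ∫ t : ℝ, h' t * cexp (w * t) = ∫ t : ℝ, cexp (w * t) * h' t := by
          congr 1 with t; ring
      _ = -∫ t : ℝ, w * cexp (w * t) * h t := key
      _ = -w * ∫ t : ℝ, h t * cexp (w * t) := by
          rw [neg_mul, ← integral_const_mul]
          congr 2 with t; ring
  · exact hi'.congr (Eventually.of_forall fun t ↦ by simp [mul_comm])
  · exact (hi.const_mul w).congr (Eventually.of_forall fun t ↦ by simp [Pi.mul_apply]; ring)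
  · exact hi.congr (Eventually.of_forall fun t ↦ by simp [mul_comm])

/-- Twice: `(h'')^(s) = (s − 1/2)² ĥ(s)` under the corresponding integrability hypotheses. [folklore] -/
theorem weilMellin_of_hasDerivAt_two {h h' h'' : ℝ → ℂ} {s : ℂ}
    (hd : ∀ t : ℝ, HasDerivAt h (h' t) t) (hd' : ∀ t : ℝ, HasDerivAt h' (h'' t) t)
    (hi : Integrable fun t : ℝ => h t * cexp ((s - 1 / 2) * t))
    (hi' : Integrable fun t : ℝ => h' t * cexp ((s - 1 / 2) * t))
    (hi'' : Integrable fun t : ℝ => h'' t * cexp ((s - 1 / 2) * t)) :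
    weilMellin h'' s = (s - 1 / 2) ^ 2 * weilMellin h s := by
  rw [weilMellin_of_hasDerivAt hd' hi' hi'', weilMellin_of_hasDerivAt hd hi hi']
  ring

/-- In the closed strip `0 ≤ Re s ≤ 1`, `‖ĥ(s)‖ ≤ ∫ ‖h‖ e^{|t|/2}` whenever the right-hand side
is a convergent integral (if `h e^{(s-1/2)t}` is not integrable the left side is `0`). [folklore] -/
theorem norm_weilMellin_le_integral_norm_mul_exp_half {h : ℝ → ℂ} {s : ℂ}
    (hs0 : 0 ≤ s.re) (hs1 : s.re ≤ 1)
    (hint : Integrable fun t : ℝ => ‖h t‖ * Real.exp (|t| / 2)) :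
    ‖weilMellin h s‖ ≤ ∫ t : ℝ, ‖h t‖ * Real.exp (|t| / 2) := by
  unfold weilMellin
  refine (norm_integral_le_integral_norm _).trans (integral_mono_of_nonneg
    (Eventually.of_forall fun _ ↦ norm_nonneg _) hint (Eventually.of_forall fun t ↦ ?_))
  simp only [norm_mul, Complex.norm_exp]
  refine mul_le_mul_of_nonneg_left (Real.exp_le_exp.2 ?_) (norm_nonneg _)
  have hre : ((s - 1 / 2) * (t : ℂ)).re = (s.re - 1 / 2) * t := by
    simp [sub_re, mul_re]
  rw [hre]
  have h1 : |s.re - 1 / 2| ≤ 1 / 2 := abs_le.2 ⟨by linarith, by linarith⟩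
  calc (s.re - 1 / 2) * t ≤ |(s.re - 1 / 2) * t| := le_abs_self _
    _ = |s.re - 1 / 2| * |t| := abs_mul _ _
    _ ≤ 1 / 2 * |t| := mul_le_mul_of_nonneg_right h1 (abs_nonneg _)
    _ = |t| / 2 := by ring

/-- **Decay in the closed strip from two derivatives**: for `0 ≤ Re s ≤ 1`, if `h, h', h''` are
as above with `∫‖h‖e^{|t|/2} ≤ τ₀` and `∫‖h''‖e^{|t|/2} ≤ τ₂`, then
`‖ĥ(s)‖ ≤ 2(τ₀ + τ₂)/(1 + (Im s)²)` (`(Im s)² ≤ |s − 1/2|²`, `min(τ₀, τ₂/γ²) ≤ 2(τ₀+τ₂)/(1+γ²)`).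
[folklore] -/
theorem norm_weilMellin_le_of_two_derivs {h h' h'' : ℝ → ℂ} {s : ℂ}
    (hs0 : 0 ≤ s.re) (hs1 : s.re ≤ 1)
    (hd : ∀ t : ℝ, HasDerivAt h (h' t) t) (hd' : ∀ t : ℝ, HasDerivAt h' (h'' t) t)
    (hi : Integrable fun t : ℝ => h t * cexp ((s - 1 / 2) * t))
    (hi' : Integrable fun t : ℝ => h' t * cexp ((s - 1 / 2) * t))
    (hi'' : Integrable fun t : ℝ => h'' t * cexp ((s - 1 / 2) * t))
    (hint : Integrable fun t : ℝ => ‖h t‖ * Real.exp (|t| / 2))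
    (hint'' : Integrable fun t : ℝ => ‖h'' t‖ * Real.exp (|t| / 2))
    {τ₀ τ₂ : ℝ} (h0 : ∫ t : ℝ, ‖h t‖ * Real.exp (|t| / 2) ≤ τ₀)
    (h2 : ∫ t : ℝ, ‖h'' t‖ * Real.exp (|t| / 2) ≤ τ₂) :
    ‖weilMellin h s‖ ≤ 2 * (τ₀ + τ₂) / (1 + s.im ^ 2) := by
  have hpos : 0 < 1 + s.im ^ 2 := by positivity
  rw [le_div_iff₀ hpos]
  have h1 : ‖weilMellin h s‖ ≤ τ₀ :=
    (norm_weilMellin_le_integral_norm_mul_exp_half hs0 hs1 hint).trans h0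
  have h2' : ‖weilMellin h'' s‖ ≤ τ₂ :=
    (norm_weilMellin_le_integral_norm_mul_exp_half hs0 hs1 hint'').trans h2
  rw [weilMellin_of_hasDerivAt_two hd hd' hi hi' hi'', norm_mul, norm_pow] at h2'
  have h3 : s.im ^ 2 ≤ ‖s - 1 / 2‖ ^ 2 := by
    have : |s.im| ≤ ‖s - 1 / 2‖ := by
      have h := Complex.abs_im_le_norm (s - 1 / 2)
      simpa using h
    nlinarith [abs_nonneg s.im, sq_abs s.im]
  have h4 : 0 ≤ ‖weilMellin h s‖ := norm_nonneg _
  have hτ₀ : 0 ≤ τ₀ := (integral_nonneg fun _ ↦ by positivity).trans h0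
  have hτ₂ : 0 ≤ τ₂ := (integral_nonneg fun _ ↦ by positivity).trans h2
  nlinarith [mul_le_mul_of_nonneg_right h3 h4]

end Summit.RiemannHypothesis.RiemannHypothesis.Theorems.GroundStatesConvergeToXi

end
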